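import Summits.ABC.IUTFork.Cor312OrbitCoveringVolumes
import Summits.ABC.IUTFork.Cor312PinnedSetting
import Summits.ABC.IUTFork.Cor312NaiveThm311
import Summits.ABC.IUTFork.Cor312PinnedRegionsThreePins
import HarnessLib

/-!
# [IUTchIII] Cor. 3.12 — the ORBIT-COVERING bed COV, IV: data (a)(b)(c), typed Thm. 3.11, the pinned setting, the region reading, the pins

Record-only file (D-0012; MODEL DATA + folklore lemmas, no `Prop` fact, nothing asserted about print) of the abc-iut cell (IUT REPAIR
branch B, sub-cell B3 Joshi, seat abc-iut-rp-j3 gen 3; rung LADDER-ABC:A2.B ⊇ A2.RP). Sequel of `Cor312OrbitCoveringShells` / `…Lattices` / `…Volumes`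
(rank-2 covering shells `covShells` with "Ism" = the lattice automorphisms, coordinates, balls `ball d = p^d·𝓘`, the ANISOTROPIC honestly
`j²`-volumed Θ-lattice `thetaLat`, the q-ball `qBall`, «every indeterminacy maps every ball onto itself», the killing lemma, the orbit `thetaOrbit`, the
monotone log-volume `covVol`), imported, not restated. Object side verbatim from abc-iut-w4-d101's pinned setting (`ExpMonoid`, `pinSig`, pilots of exponent `1`, p418585) and
abc-iut-w5-d247's `naiveLink` / tagged Frobenioid copies (`FrobObj`, `kum`), as in rp-s2's `Repair/ObstructionSS16` whose layout this file
follows. TAKES NO SIDE on [IUTchIII] Cor. 3.12 or on any author; typed ≠ proved; instantiated ≠ endorsed.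

THIS FILE:
* §11 data (a)(b)(c) `covData` (integral structure `𝓘`, splitting monoid `covPsi` = the star-data whose components lie in the Θ-lattices), the
  constant columns `covColumn` (identity Kummer transport), the full situation `covFull` (link data `naiveLink`), and **the typed Theorem 3.11
  (i) ∧ (ii) ∧ (iii) HOLDS** (`covFull_statement`);
* §12 the setting `covSetting` (column `0`; frame `{𝓘, p·𝓘}`; glue: Θ-pilot ↦ the Θ-lattice, q-pilot ↦ the q-ball), the REGION READING `rho`
  («the set of `j`-components of the datum»; `𝓘 = thetaLat 0` at the zero label), its (hρ)-equivariance under the whole group, and **the three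
  pins** `cov_pinnedRegions3` with the q-pilot Kummer datum `covQK` (components in the q-balls) — a genuine datum, NOT a translate of `covPsi`.
HONEST SCOPE: interface-level toy (`l⋇ = 2`, one place, rank 2; the Θ-image is honestly VOLUMED but ANISOTROPIC); standard axioms; nothing
asserted. S. Mochizuki, *Inter-universal Teichmüller theory III*, kurims manuscript (May 2020) = `paper:url-4b091feeb646` (cell render).
[claim: Mochizuki2012, status: disputed] for every IUT noun.
-/

noncomputable section

open Set

namespace Summit.ABC.IUTFork.Cor312Vol

namespace CoveringWitness

open Thm311 Cor312 Cor312.Checks Cor312.IdentifiedNonVacuity NaiveWitness PinnedWitness Literature.IUT.LogThetaLattice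

variable (p : ℕ) [hp : Fact p.Prime]

/-! ## 11. Data (a)(b)(c), the columns, the full situation; the typed Theorem 3.11 holds -/

/-- **The SPLITTING MONOID `Ψ_v` of COV**: the star-data whose `j`-components lie in the Θ-lattices (so that its region at `j` IS the
Θ-lattice). MODEL DATA. [claim: Mochizuki2012, status: disputed] -/
def covPsi (v : toyIndex.V) (_ : v ∈ toyIndex.Vbad) : Set (covShells.StarPacket v) := {ψ | ∀ j, ψ j ∈ thetaLat p j.1 (toyIndex.over v)}

/-- **The q-pilot's KUMMER DATUM `covQK`**: the star-data whose `j`-components lie in the q-balls — a genuine datum of the packets, NOT an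
⟨(Ind1)∪(Ind2)⟩-translate of `covPsi`. MODEL DATA. [claim: Mochizuki2012, status: disputed] -/
def covQK (v : toyIndex.V) (_ : v ∈ toyIndex.Vbad) : Set (covShells.StarPacket v) := {ψ | ∀ j, ψ j ∈ qBall p j.1 (toyIndex.over v)}

/-- **Data (a)(b)(c) of every vertical line** ([IUTchIII] Thm. 3.11 (i)) of COV: integral structure `𝓘 = ball 0`, admissible regions the balls
and the orbit of the Θ-lattice, log-volume `covVol`, splitting monoid `covPsi`. MODEL DATA. [claim: Mochizuki2012, status: disputed] -/
def covData : MRData covShells where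
  shellPk := fun j vQ => ball p j vQ 0
  shellSub := fun j v => ball p j (toyIndex.over v) 0
  Adm := fun j vQ A => (∃ d : ℕ, A = ball p j vQ d) ∨ A ∈ thetaOrbit p j vQ
  logvol := fun j vQ => covVol p j vQ
  Ψ := covPsi p
  act := fun _ _ _ => 0
  Mmod := fun _ => Set.univ

omit hp in
/-- ADMISSIBLE REGIONS `𝕄(𝓘^ℚ(−))` of COV: balls and orbit members (unfolding lemma). [folklore] -/
theorem adm_iff (j : toyIndex.Label) (vQ : toyIndex.VQ) (A : Set (covShells.Packet j vQ)) :
    (covData p).Adm j vQ A ↔ (∃ d : ℕ, A = ball p j vQ d) ∨ A ∈ thetaOrbit p j vQ := Iff.rfl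

/-- (c)'s global realified Frobenioids: one object, degree `0`, region `𝓘`. MODEL DATA. [claim: Mochizuki2012, status: disputed] -/
def covDegrees (j : toyIndex.LabelStar) : GlobalDegrees covShells j where
  ObjMOD := Unit
  Objmod := Unit
  natIso := Equiv.refl Unit
  deg := fun _ => 0
  region := fun _ vQ => ball p j.1 vQ 0

/-- The SITUATION of COV (every vertical line carries the same data; an `abbrev`). MODEL DATA. [claim: Mochizuki2012, status: disputed] -/
abbrev covSituation : Situation toyIndex where
  L := covShells
  D := fun _ => covData p
  G := fun _ j => covDegrees p j

/-- **The column data** ([IUTchIII] Thm. 3.11 (ii)) of COV: identity Kummer transport at every `(n, m)` ((ii)(b) by `rfl`), unit-group and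
ball images `𝓘`, Frobenioid objects abc-iut-w5-d247's tagged copies of `ℤ`, Θ-pilot the object of index `1`. MODEL DATA. [claim: Mochizuki2012, status: disputed] -/
def covColumn : Column covShells where
  frobAdm := fun _ => (covData p).Adm
  frobLogvol := fun _ j vQ => covVol p j vQ
  frobΨ := fun _ => covPsi p
  frobMmod := fun _ _ => Set.univ
  unitImage := fun _ _ j vQ => ball p j vQ 0
  ballImage := fun _ j vQ => ball p j vQ 0
  ObjLGP := ℤ
  frobObjLGP := FrobObj
  kumLGP := kum
  ObjLgp := ℤ
  frobObjLgp := FrobObj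
  kumLgp := kum
  thetaPilot := fun m => ⟨(1, m), rfl⟩

/-- **The full situation of COV** (link data: abc-iut-w5-d247's `naiveLink`). MODEL DATA. [claim: Mochizuki2012, status: disputed] -/
abbrev covFull : FullSituation toyIndex where
  toSituation := covSituation p
  col := fun _ => covColumn p
  link := naiveLink

omit hp in
/-- Over the one-place index the sub-packet `𝓘^ℚ(^{S^±_{j+1},j};𝒟⊢_v)` is the whole packet. [folklore] -/
theorem subPacket_eq_top (j : toyIndex.Label) (v : toyIndex.V) : covShells.SubPacket j v = ⊤ := by
  haveI : Subsingleton toyIndex.V := inferInstanceAs (Subsingleton Unit)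
  refine top_unique fun x _ => ?_
  have hx : x ∈ Submodule.span ℚ (Set.range (PiTensorProduct.tprod ℚ
      (s := fun _ : toyIndex.Caps j => covShells.Packet1 (toyIndex.over v)))) := by
    rw [PiTensorProduct.span_tprod_eq_top]; trivial
  refine Submodule.span_mono ?_ hx
  rintro _ ⟨y, rfl⟩
  exact ⟨y, fun w hw => absurd (Subsingleton.elim _ _) hw, rfl⟩

/-- **THE TYPED THEOREM 3.11 (i) ∧ (ii) ∧ (iii) HOLDS in COV** (`FullSituation.Statement`). [folklore] -/
theorem covFull_statement : (covFull p).Statement := by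
  have hI : (covFull p).PartI := by
    refine ⟨fun n v hv x _ j => ?_, fun n j J => ⟨fun vQ => Or.inl ⟨0, rfl⟩, Set.toFinite _, ?_⟩, fun _ _ => rfl⟩
    · show x j ∈ covShells.SubPacket j.1 v
      rw [subPacket_eq_top]; trivial
    · show (0 : ℝ) = ∑ᶠ vQ, covVol p j.1 vQ (ball p j.1 vQ 0)
      simp only [covVol_ball, Nat.cast_zero, neg_zero, finsum_zero]
  refine ⟨hI, fun n => ?_, ?_⟩
  · exact (Column.partII_iff _ _).2 ⟨fun m j vQ A hA => ⟨hA, rfl⟩, fun _ _ _ => rfl, fun _ _ => rfl,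
      fun _ _ _ _ _ => Set.Subset.rfl, fun _ _ _ h => absurd trivial h⟩
  · refine ⟨naiveLink.partIIIa_holds, naiveLink.partIIIb_holds, ?_, ?_, (covFull p).evalCompatUpToInd_of_multiradialCompat hI.2.2⟩
    · refine naiveLink.partIIIc_of_full (fun _ => rfl) fun n m => ?_
      rintro _ ⟨a, rfl⟩
      show unitIso a ≪≫ unitIso ((-1) ^ m.natAbs) = unitIso ((-1) ^ m.natAbs) ≪≫ unitIso a
      rw [unitIso_trans, unitIso_trans, mul_comm]
    · intro n m; exact Thm311.PolyIsoCalc.stabilized_full _ _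

omit hp in
/-- Thm. 3.11 (ii)(b) for every column of COV (identity transport: `rfl`). [folklore] -/
theorem cov_kummerB (n : ℤ) : ((covFull p).col n).KummerB ((covFull p).D n) := fun _ _ _ => rfl

omit hp in
/-- Thm. 3.11 (i) `MultiradialCompat` for COV (constant columns). [folklore] -/
theorem cov_multiradialCompat : (covFull p).MultiradialCompat := fun _ _ => rfl

/-! ## 12. The pinned setting, the region reading `rho`, the three pins -/

variable (j vQ)

/-- `p·𝓘 ⊆ 𝓘`. [folklore] -/
theorem ball_one_subset_ball_zero : ball p j vQ 1 ⊆ ball p j vQ 0 := (ball_subset_ball_iff p vQ 1 0).2 (Nat.zero_le 1)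

/-- **The HULL FRAME of COV** at label `j`: hull-sets `𝓘` and `p·𝓘`; «relatively compact» = inside `𝓘`; every bounded region admits its hull
(the least of the two balls containing it). MODEL DATA. [claim: Mochizuki2012, status: disputed] -/
def covFrame : HullFrame (covShells.Packet j vQ) where
  Hul := {H | H = ball p j vQ 0 ∨ H = ball p j vQ 1}
  IsBounded := fun U => U ⊆ ball p j vQ 0
  HasHull := fun _ => True
  hul_bounded := by
    rintro H (rfl | rfl)
    · exact Set.Subset.rfl
    · exact ball_one_subset_ball_zero p j vQ
  bounded_mono := fun _ _ h h' => h.trans h'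
  exists_hul := fun U hU => ⟨ball p j vQ 0, Or.inl rfl, hU⟩
  hull_mem := fun U hU _ => by
    by_cases hb : U ⊆ ball p j vQ 1
    · refine Or.inr (Set.Subset.antisymm (Set.sInter_subset_of_mem ⟨Or.inr rfl, hb⟩) (Set.subset_sInter ?_))
      rintro H ⟨(rfl | rfl), -⟩
      · exact ball_one_subset_ball_zero p j vQ
      · exact Set.Subset.rfl
    · refine Or.inl (Set.Subset.antisymm (Set.sInter_subset_of_mem ⟨Or.inl rfl, hU⟩) (Set.subset_sInter ?_))
      rintro H ⟨(rfl | rfl), hUH⟩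
      · exact Set.Subset.rfl
      · exact absurd hUH hb

/-- The q-ball is a hull-set. [folklore] -/
theorem qBall_mem_hul : qBall p j vQ ∈ (covFrame p j vQ).Hul := by
  unfold qBall qDepth
  split_ifs
  · exact Or.inl rfl
  · exact Or.inr rfl

variable {j vQ}

/-- **The PINNED SETTING of COV** (column `n = 0`): abc-iut-w4-d101's honest object side verbatim; frames `covFrame`; GLUE: the Θ-pilot's
`(n,m)`-Kummer image at label `j` is the Θ-lattice, the q-pilot's image the q-ball. MODEL DATA. [claim: Mochizuki2012, status: disputed] -/
def covSetting : Setting (covSituation p) where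
  n := 0
  HT := ℤ × ℤ
  LogLink := fun _ _ => Unit
  IsFull := fun _ => True
  lattice :=
    { theater := fun n m => (n, m)
      distinct := fun p q h => by simpa using h
      logLink := fun _ _ => ()
      logLink_full := fun _ _ => trivial }
  Frd := Unit
  IsoF := fun _ _ => Unit
  Ob := fun _ => ℤ
  realify := id
  Strip := Unit
  IsoS := fun _ _ => Unit
  M := fun _ _ => ExpMonoid
  sig := pinSig
  split := { Msplit := fun _ _ => ⊤, exists_gen := fun _ _ => ⟨⟨gen, trivial⟩, top_gen_isGenerator⟩ }
  ObΔ := ℤ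
  N := fun _ _ => ExpMonoid
  qData :=
    { q := fun _ _ => gen
      q_gen := fun _ _ => gen_isGenerator
      objOf := fun x => (expOf (x () (Set.mem_univ ())) : ℤ) }
  frame := fun j vQ => covFrame p j vQ
  hul_adm := fun j vQ H hH => by
    rcases hH with rfl | rfl
    · exact Or.inl ⟨0, rfl⟩
    · exact Or.inl ⟨1, rfl⟩
  thetaRegionOf := fun _ _ j vQ => thetaLat p j vQ
  qRegionOf := fun _ j vQ => qBall p j vQ
  qRegion_mem := fun j vQ => qBall_mem_hul p j vQ
  qSupport_finite := fun _ => Set.toFinite _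

/-- The Θ-pilot object is the lgp-object of exponent `1`. [folklore] -/
theorem covSetting_thetaPilot : (covSetting p).thetaPilot = (1 : ℤ) :=
  congrArg (Nat.cast : ℕ → ℤ)
    (expOf_eq_one_of_isGenerator_top (Classical.choose_spec ((covSetting p).split.exists_gen () (Set.mem_univ ()))))

/-- The q-pilot object is the `△`-object of exponent `1`. [folklore] -/
theorem covSetting_qPilot : (covSetting p).qPilot = (1 : ℤ) := rfl

/-- The `(n,m)`-Kummer image of the Θ-pilot is the Θ-lattice. [folklore] -/
theorem covSetting_thetaRegion (m : ℤ) (j : toyIndex.Label) (vQ : toyIndex.VQ) : (covSetting p).thetaRegion m j vQ = thetaLat p j vQ := rfl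

/-- The (Ind3)-enlarged Θ-region is the Θ-lattice (constant in `m`). [folklore] -/
theorem covSetting_thetaRegion3 (j : toyIndex.Label) (vQ : toyIndex.VQ) : (covSetting p).thetaRegion3 j vQ = thetaLat p j vQ := by
  unfold Setting.thetaRegion3
  simp only [covSetting_thetaRegion, Set.iUnion_const]

/-- The image of the q-pilot is the q-ball. [folklore] -/
theorem covSetting_qRegion (j : toyIndex.Label) (vQ : toyIndex.VQ) : (covSetting p).qRegion j vQ = qBall p j vQ := rfl

/-- **The REGION READING `rho`**: at `j ∈ 𝔽_l^⋇` the set of `j`-components of the datum (the natural, component-wise reading); at the zero label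
(no component) the unit lattice `𝓘 = thetaLat 0`. MODEL DATA. [claim: Mochizuki2012, status: disputed] -/
def rho (X : ∀ v : toyIndex.V, v ∈ toyIndex.Vbad → Set (covShells.StarPacket v)) (j : toyIndex.Label) (vQ : toyIndex.VQ) :
    Set (covShells.Packet j vQ) :=
  if h : j = 0 then thetaLat p j vQ else {y | ∃ ψ ∈ X () trivial, ψ ⟨j, h⟩ = y}

omit hp in
/-- The projection of a product-shaped star-datum onto a nonzero label. [folklore] -/
theorem rho_pi {j : toyIndex.Label} (hj : j ≠ 0) (B : ∀ j' : toyIndex.LabelStar, Set (covShells.Packet j'.1 ()))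
    (hB : ∀ j', (0 : covShells.Packet j'.1 ()) ∈ B j') (vQ : toyIndex.VQ) :
    rho p (fun _ _ => {ψ | ∀ j', ψ j' ∈ B j'}) j vQ = B ⟨j, hj⟩ := by
  haveI : DecidableEq toyIndex.LabelStar := Classical.decEq _
  obtain rfl : vQ = () := rfl
  unfold rho
  rw [dif_neg hj]
  ext y
  constructor
  · rintro ⟨ψ, hψ, rfl⟩; exact hψ _
  · intro hy
    refine ⟨Function.update (fun j' => (0 : covShells.Packet j'.1 ())) ⟨j, hj⟩ y, fun j' => ?_, Function.update_self _ _ _⟩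
    by_cases h : j' = ⟨j, hj⟩
    · subst h; rwa [Function.update_self]
    · rw [Function.update_of_ne h]; exact hB j'

omit hp in
/-- `rho(Ψ)` is the Θ-lattice at every label. [folklore] -/
theorem rho_covPsi (j : toyIndex.Label) (vQ : toyIndex.VQ) : rho p (covPsi p) j vQ = thetaLat p j vQ := by
  by_cases hj : j = 0
  · subst hj; unfold rho; rw [dif_pos rfl]
  · obtain rfl : vQ = () := rfl
    exact rho_pi p hj (fun j' => thetaLat p j'.1 ()) (fun j' => zero_mem_glat p () _) ()

omit hp in
/-- `rho(qK)` is the q-ball at every label (at the zero label `thetaLat 0 = qBall 0 = 𝓘`). [folklore] -/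
theorem rho_covQK (j : toyIndex.Label) (vQ : toyIndex.VQ) : rho p (covQK p) j vQ = qBall p j vQ := by
  by_cases hj : j = 0
  · subst hj; unfold rho; rw [dif_pos rfl]; exact thetaLat_zero p vQ
  · obtain rfl : vQ = () := rfl
    exact rho_pi p hj (fun j' => qBall p j'.1 ()) (fun j' => zero_mem_glat p () _) ()

omit hp in
/-- **(hρ) FOR THE WHOLE INDETERMINACY GROUP**: every `Φ ∈ ⟨(Ind1) ∪ (Ind2)⟩` satisfies `rho(Φ·X) = Φ '' rho(X)` (at the zero label because `Φ`
fixes the ball `𝓘`; at `j ≥ 1` because taking `j`-components commutes with `Φ`). [folklore] -/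
theorem rho_equivariant {Φ : covShells.PacketAut} (hΦ : Φ ∈ covGroup)
    (X : ∀ v : toyIndex.V, v ∈ toyIndex.Vbad → Set (covShells.StarPacket v)) (j : toyIndex.Label) (vQ : toyIndex.VQ) :
    rho p (fun v hv => covShells.starAut Φ v '' X v hv) j vQ = Φ j vQ '' rho p X j vQ := by
  obtain rfl : vQ = toyIndex.over () := rfl
  by_cases h : j = 0
  · subst h
    unfold rho
    rw [dif_pos rfl, dif_pos rfl, thetaLat_zero]
    exact (image_ball_of_mem_closure p hΦ 0 _ _).symm
  · unfold rho
    rw [dif_neg h, dif_neg h]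
    ext y
    simp only [Set.mem_setOf_eq, Set.mem_image, exists_exists_and_eq_and]
    rfl

/-- **THE Θ-PIN** (pΘ) with (hρ) for the whole group. [claim: Mochizuki2012, status: disputed] -/
theorem cov_thetaPinned : ThetaPinned (covFull p).toLatticeSituation (covSetting p) (rho p) :=
  ⟨fun Φ hΦ X j vQ => rho_equivariant p hΦ X j vQ, fun m j vQ => by rw [covSetting_thetaRegion]; exact (rho_covPsi p j vQ).symm⟩

/-- **THE q-PIN** (pq′). [claim: Mochizuki2012, status: disputed] -/
theorem cov_qPinned : QPinned (covFull p).toLatticeSituation (covSetting p) (rho p) (covQK p) := fun j vQ => by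
  rw [covSetting_qRegion, rho_covQK]

/-- **(pL) — the link pin** (identity of exponents; pilots of exponent `1`). [folklore] -/
theorem cov_linkPinned : LinkPinned (covFull p).toLatticeSituation (covSetting p) :=
  ⟨Equiv.refl ℤ, by rw [covSetting_thetaPilot, covSetting_qPilot]; rfl⟩

/-- **`PinnedRegions3` HOLDS in COV.** [claim: Mochizuki2012, status: disputed] -/
theorem cov_pinnedRegions3 : PinnedRegions3 (covFull p).toLatticeSituation (covSetting p) (rho p) (covQK p) :=
  ⟨⟨cov_thetaPinned p, cov_qPinned p⟩, cov_linkPinned p⟩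

end CoveringWitness

end Summit.ABC.IUTFork.Cor312Vol

end
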